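import Summits.ABC.ABC.Theses.IneffectiveSubspace
import Summits.ABC.ABC.Theorems.IneffectiveSubspaceDeepRegimeABCCensusProfile
import Summits.ABC.ABC.Theorems.IneffectiveSubspaceDeepRegimeABCCensusFirstHitEight
import Summits.ABC.ABC.Theorems.IneffectiveSubspaceDeepRegimeABCCensusStaircaseUpper
import Summits.ABC.ABC.Theorems.IneffectiveSubspaceDeepRegimeABCCensusStaircaseTwoSided

/-!
# `DeepRegimeABC` (stmt-ABC-15121): the certified profile of the deep regime — v2 (one statement)

Assembly file (line lead `prover-line-stmt-ABC-15121-c4-0`, 2026-08-17; human certificate objective) for the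
crux `Summit.ABC.ABC.Theses.IneffectiveSubspace.DeepRegimeABC` (abc with exponent `1 + ε` on the deep tail
`{ω₅(abc) ≥ K(ε)}`, `ω₅(n) := #{p : p⁵ ∣ n}`).  Supersedes `…CensusProfile.lean` (lead c3-0, `censusProfile`,
restated here as the first conjunct) as the citation point, adding the certificates of the lead c4-0:

1. (`censusProfile`, c1–c3) first members `c_K` exactly for `K ≤ 9`; `ω₅ ≤ 8` below `10¹⁸`, `≤ 9` below
   `10²⁰`; staircase `c > 10^(2K-1)` for every `K ≥ 8` and the primorial floor `4·(p₀⋯p_{K-1})⁵ ≤ c³` for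
   every `K`; the thirty members of the cell `ω₅ ≥ 8` below `10¹⁷`, none a hit; records `> 1.2138` /
   `> 1.0790` in the cells `ω₅ ≥ 7` / `ω₅ ≥ 8` (constant-free thresholds `≥ 8` at `ε ≤ 0.2138`, `≥ 9` at
   `ε ≤ 0.079`);
2. (`censusFirstHitEight`, **new, exhaustive**) **the first HIT of the cell `ω₅ ≥ 8` is exactly
   `c = 241577404379538353 = 7⁵·29⁵·43²·379`** (`= 2⁶·5·11⁵·17⁵·373 + 3⁷·13⁵·23⁵·41`, quality `1.0268`), the
   only hit of the cell with `c ≤ 241577404379538353` (40-chunk cover, `…CensusFirstHitEight{A–T}.lean`);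
3. (`censusStaircaseUpper`, **new, kernel-only**) explicit members of the cells `ω₅ ≥ 10, …, 14`:
   `c₁₀ ≤ 20087542092542384706057` (`3⁵·7⁵·17⁵·19⁵·1399`), `c₁₁ ≤ 1.47·10²⁶`, `c₁₂ ≤ 3.09·10²⁹`,
   `c₁₃ ≤ 7.32·10³³`, `c₁₄ ≤ 3.53·10³⁷`, and `c² ≤ (p₀⋯p_{K-1})⁵` for some member, `6 ≤ K ≤ 14`;
4. (`censusStaircaseTwoSided`, **new, structural, every `K ≥ 1`**) some member of the cell `ω₅ ≥ K` has
   `c² ≤ p_{K-1}¹⁰·(p₀⋯p_{K-1})⁵` and every member has `4·(p₀⋯p_{K-1})⁵ ≤ c³`: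
   `(5/3)ϑ(p_{K-1}) + (log 4)/3 ≤ log c_K ≤ (5/2)ϑ(p_{K-1}) + 5 log p_{K-1}` — the staircase has no upper
   end on either side.

Uncertified context (the lead's independent C enumerator `cert/deep5.c`, validated against every certified
datum; kit j021560 / j022498 and local runs): the exhaustive enumeration of the cell `ω₅ ≥ 10` to `10²³`
(`2.34·10¹⁰` depth patterns, `2.0·10¹¹` outer steps, 4 core-hours) finds exactly THREE members below `10²³`, the
least being the witness of item 3 — so **`c₁₀ = 20087542092542384706057 = 3⁵·7⁵·17⁵·19⁵·1399` exactly** (by C;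
in Lean: a member, and `c₁₀ > 10²⁰`), then `95127714080207078955091`, `96459459395981350043419`; the cell
`ω₅ ≥ 9` has eighteen members and no hit below `10²⁰`; `log c_K ≈ 2.3·log(p₀⋯p_{K-1})` for `7 ≤ K ≤ 20`
(near the structural ceiling `5/2`).  The lattice minimisation over the first `K` primes (`cert/minmem.c`)
thus returns `c₆, …, c₁₀` exactly.

Everything is imported; this file only conjoins the four registered statements.  Nothing here bears on the
truth of the crux (abc-hard: `¬crux ⟹ ¬ABC`); it is the requested checkable enumeration witness of the deep
regime, kernel-checked modulo the `native_decide` runs of the imported certificate files.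
-/

-- `Summit.<Summit>.<Problem>` is the mandated summit-side namespace (CONVENTIONS §2); for the
-- single-conjunct summit `ABC` the two coincide, so the duplicate `ABC.ABC` is deliberate.
set_option linter.dupNamespace false

namespace Summit.ABC.ABC.Theorems.DeepRegimeABC

open Literature.NumberTheory.DiophantineGeometry

/-! ## The full profile, v2 -/

/-- **The certified profile of the deep regime, v2, in full**: `censusProfile` (c1–c3) ∧ `censusFirstHitEight` ∧
`censusStaircaseUpper` ∧ `censusStaircaseTwoSided` (c4-0). [folklore] -/
theorem censusProfileV2_full : ((∀ a b c K : ℕ, Literature.NumberTheory.DiophantineGeometry.IsABCTriple a b c → 1 ≤ K → K ≤ 9 → K ≤ ((a * b * c).primeFactors.filter (fun p => 5 ≤ (a * b * c).factorization p)).card → Summit.ABC.ABC.Theorems.DeepRegimeABC.firstMemberOf K ≤ c) ∧ (∀ K : ℕ, 1 ≤ K → K ≤ 9 → ∃ a b c : ℕ, Literature.NumberTheory.DiophantineGeometry.IsABCTriple a b c ∧ K ≤ ((a * b * c).primeFactors.filter (fun p => 5 ≤ (a * b * c).factorization p)).card ∧ c = Summit.ABC.ABC.Theorems.DeepRegimeABC.firstMemberOf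 K) ∧ (∀ a b c : ℕ, Literature.NumberTheory.DiophantineGeometry.IsABCTriple a b c → c ≤ 10 ^ 18 → ((a * b * c).primeFactors.filter (fun p => 5 ≤ (a * b * c).factorization p)).card ≤ 8) ∧ (∀ a b c : ℕ, Literature.NumberTheory.DiophantineGeometry.IsABCTriple a b c → c ≤ 10 ^ 20 → ((a * b * c).primeFactors.filter (fun p => 5 ≤ (a * b * c).factorization p)).card ≤ 9) ∧ (∀ a b c K : ℕ, Literature.NumberTheory.DiophantineGeometry.IsABCTriple a b c → 8 ≤ K → K ≤ ((a * b * c).primeFactors.filter (fun p => 5 ≤ (a * b * c).factorization p)).card → 10 ^ (2 * K - 1) < c) ∧ (∀ a b c K : ℕ, Literature.NumberTheory.DiophantineGeometry.IsABCTriple a b c → K ≤ ((a * b * c).primeFactors.filter (fun p => 5 ≤ (a * b * c).factorization p)).card → 4 * (∏ i ∈ Finset.range K, Nat.nth Nat.Prime i) ^ 5 ≤ c ^ 3) ∧ (∀ a b c : ℕ, Literature.NumberTheory.DiophantineGeometry.IsABCTriple a b c → c ≤ 10 ^ 17 → 8 ≤ ((a * b * c).primeFactors.filter (fun p => 5 ≤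 (a * b * c).factorization p)).card → ((a, b, c) ∈ Summit.ABC.ABC.Theorems.DeepRegimeABC.cellEightMembers17 ∨ (b, a, c) ∈ Summit.ABC.ABC.Theorems.DeepRegimeABC.cellEightMembers17) ∧ c ≤ Literature.NumberTheory.DiophantineGeometry.rad a b c) ∧ (∀ ε : ℝ, ε ≤ 0.2138 → ∀ K : ℕ, (∀ a b c : ℕ, Literature.NumberTheory.DiophantineGeometry.IsABCTriple a b c → K ≤ ((a * b * c).primeFactors.filter (fun p => 5 ≤ (a * b * c).factorization p)).card → (c : ℝ) < ((Literature.NumberTheory.DiophantineGeometry.rad a b c : ℕ) : ℝ) ^ (1 + ε)) → 8 ≤ K) ∧ (∀ ε : ℝ, ε ≤ 0.079 → ∀ K : ℕ, (∀ a b c : ℕ, Literature.NumberTheory.DiophantineGeometry.IsABCTriple a b c → K ≤ ((a * b * c).primeFactors.filter (fun p => 5 ≤ (a * b * c).factorization p)).card → (c : ℝ) < ((Literature.NumberTheory.DiophantineGeometry.rad a b c : ℕ) : ℝ) ^ (1 + ε)) → 9 ≤ K)) ∧ ((∀ a b c : ℕ, Literature.NumberTheory.DiophantineGeometry.IsABCTriple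 a b c → 8 ≤ ((a * b * c).primeFactors.filter (fun p => 5 ≤ (a * b * c).factorization p)).card → Literature.NumberTheory.DiophantineGeometry.rad a b c < c → 241577404379538353 ≤ c) ∧ (∃ a b c : ℕ, Literature.NumberTheory.DiophantineGeometry.IsABCTriple a b c ∧ 8 ≤ ((a * b * c).primeFactors.filter (fun p => 5 ≤ (a * b * c).factorization p)).card ∧ Literature.NumberTheory.DiophantineGeometry.rad a b c < c ∧ c = 241577404379538353) ∧ (∀ a b c : ℕ, Literature.NumberTheory.DiophantineGeometry.IsABCTriple a b c → c ≤ 241577404379538353 → 8 ≤ ((a * b * c).primeFactors.filter (fun p => 5 ≤ (a * b * c).factorization p)).card → Literature.NumberTheory.DiophantineGeometry.rad a b c < c → ((a, b, c) = (27293978355427520, 214283426024110833, 241577404379538353) ∨ (b, a, c) = (27293978355427520, 214283426024110833, 241577404379538353)) ∧ Literature.NumberTheory.DiophantineGeometry.rad a b c = 84865356819813570)) ∧ ((∃ a b c : ℕ, Literature.NumberTheory.DiophantineGeometry.IsABCTriple a b c ∧ 10 ≤ ((a * b * c).primeFactors.filter (fun p => 5 ≤ (a * b * c).factorization p)).card ∧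 c = 20087542092542384706057) ∧ (∃ a b c : ℕ, Literature.NumberTheory.DiophantineGeometry.IsABCTriple a b c ∧ 11 ≤ ((a * b * c).primeFactors.filter (fun p => 5 ≤ (a * b * c).factorization p)).card ∧ c = 146672656712416414459240625) ∧ (∃ a b c : ℕ, Literature.NumberTheory.DiophantineGeometry.IsABCTriple a b c ∧ 12 ≤ ((a * b * c).primeFactors.filter (fun p => 5 ≤ (a * b * c).factorization p)).card ∧ c = 308694003304941019606135871968) ∧ (∃ a b c : ℕ, Literature.NumberTheory.DiophantineGeometry.IsABCTriple a b c ∧ 13 ≤ ((a * b * c).primeFactors.filter (fun p => 5 ≤ (a * b * c).factorization p)).card ∧ c = 7316606671822147359075478944700000) ∧ (∃ a b c : ℕ, Literature.NumberTheory.DiophantineGeometry.IsABCTriple a b c ∧ 14 ≤ ((a * b * c).primeFactors.filter (fun p => 5 ≤ (a * b * c).factorization p)).card ∧ c = 35208038765877005826676073396121904256) ∧ (∀ K : ℕ, 6 ≤ K → K ≤ 14 → (∃ a b c : ℕ, Literature.NumberTheory.DiophantineGeometry.IsABCTriple a b c ∧ K ≤ ((a * b * c).primeFactors.filter (fun p =>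 5 ≤ (a * b * c).factorization p)).card ∧ c ^ 2 ≤ (∏ i ∈ Finset.range K, Nat.nth Nat.Prime i) ^ 5) ∧ (∀ a b c : ℕ, Literature.NumberTheory.DiophantineGeometry.IsABCTriple a b c → K ≤ ((a * b * c).primeFactors.filter (fun p => 5 ≤ (a * b * c).factorization p)).card → 4 * (∏ i ∈ Finset.range K, Nat.nth Nat.Prime i) ^ 5 ≤ c ^ 3))) ∧ (∀ K : ℕ, 1 ≤ K → (∃ a b c : ℕ, Literature.NumberTheory.DiophantineGeometry.IsABCTriple a b c ∧ K ≤ ((a * b * c).primeFactors.filter (fun p => 5 ≤ (a * b * c).factorization p)).card ∧ c ^ 2 ≤ (Nat.nth Nat.Prime (K - 1)) ^ 10 * (∏ i ∈ Finset.range K, Nat.nth Nat.Prime i) ^ 5) ∧ (∀ a b c : ℕ, Literature.NumberTheory.DiophantineGeometry.IsABCTriple a b c → K ≤ ((a * b * c).primeFactors.filter (fun p => 5 ≤ (a * b * c).factorization p)).card → 4 * (∏ i ∈ Finset.range K, Nat.nth Nat.Prime i) ^ 5 ≤ c ^ 3)) :=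
  ⟨censusProfile, censusFirstHitEight, censusStaircaseUpper, censusStaircaseTwoSided⟩

/-! ## Registered certificate stub of the crux item (stmt-ABC-15121) -/

/-- **Registered certificate `censusProfileV2`** (crux `DeepRegimeABC`, line SketchIdeator5R2, human certificate
objective) — the headline additions of v2: the first hit of the cell `ω₅ ≥ 8` is exactly `c = 241577404379538353`
(least, attained); the cell `ω₅ ≥ 10` has a member with `c = 20087542092542384706057`; for every `K ≥ 1` the cell
`ω₅ ≥ K` has a member with `c² ≤ p_{K-1}¹⁰·(p₀⋯p_{K-1})⁵` and all its members have `4·(p₀⋯p_{K-1})⁵ ≤ c³`.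
The full conjunction is `censusProfileV2_full`. [folklore] -/
theorem censusProfileV2 : (∀ a b c : ℕ, Literature.NumberTheory.DiophantineGeometry.IsABCTriple a b c → 8 ≤ ((a * b * c).primeFactors.filter (fun p => 5 ≤ (a * b * c).factorization p)).card → Literature.NumberTheory.DiophantineGeometry.rad a b c < c → 241577404379538353 ≤ c) ∧ (∃ a b c : ℕ, Literature.NumberTheory.DiophantineGeometry.IsABCTriple a b c ∧ 8 ≤ ((a * b * c).primeFactors.filter (fun p => 5 ≤ (a * b * c).factorization p)).card ∧ Literature.NumberTheory.DiophantineGeometry.rad a b c < c ∧ c = 241577404379538353) ∧ (∃ a b c : ℕ, Literature.NumberTheory.DiophantineGeometry.IsABCTriple a b c ∧ 10 ≤ ((a * b * c).primeFactors.filter (fun p => 5 ≤ (a * b * c).factorization p)).card ∧ c = 20087542092542384706057) ∧ (∀ K : ℕ, 1 ≤ K → ∃ a b c : ℕ, Literature.NumberTheory.DiophantineGeometry.IsABCTriple a b c ∧ K ≤ ((a * b * c).primeFactors.filter (fun p => 5 ≤ (a * b * c).factorization p)).card ∧ c ^ 2 ≤ (Nat.nth Nat.Prime (K - 1)) ^ 10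 * (∏ i ∈ Finset.range K, Nat.nth Nat.Prime i) ^ 5) ∧ (∀ a b c K : ℕ, Literature.NumberTheory.DiophantineGeometry.IsABCTriple a b c → K ≤ ((a * b * c).primeFactors.filter (fun p => 5 ≤ (a * b * c).factorization p)).card → 4 * (∏ i ∈ Finset.range K, Nat.nth Nat.Prime i) ^ 5 ≤ c ^ 3) :=
  ⟨censusFirstHitEight.1, censusFirstHitEight.2.1, censusStaircaseUpper.1,
    fun K hK => (censusStaircaseTwoSided K hK).1,
    fun _ _ _ _ h hK => four_mul_primorial_pow_le_cube h hK⟩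

end Summit.ABC.ABC.Theorems.DeepRegimeABC
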